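import Literature.AlgebraicGeometry.HodgeTheory.CyclicCoverUniversalFamily
import Literature.AlgebraicGeometry.HodgeTheory.UniversalHypersurfaceEhresmann
import Literature.AlgebraicGeometry.FundamentalGroup.HypersurfaceComplementMeridians
import HarnessLib

/-!
# The local monodromy of a meridian of the universal family of cyclic covers of the plane is the cyclic
# reflection; the monodromy invariants are the covering invariants (Carlson–Toledo 1999 §1, §2, §3, §6;
# two named facts, the LOCAL halves of the Picard–Lefschetz package `carlsonToledo1999_cyclicReflectionSystem`)

Family `hodge`, layer `Literature/AlgebraicGeometry/HodgeTheory`. Written by the prover seat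
`hodge-nonav-prover-Bx` (g8, cell `hodge-nonav`) for crux K1 `VeryGeneralDeckCommutatorsInHg` of the route
`Summits/HodgeConjecture/HodgeConjecture/Theses/CyclicUnitaryPowers.lean` (stmt-HodgeConjecture-19544).

The tree's cited fact `carlsonToledo1999_cyclicReflectionSystem` (`CyclicCoverUniversalFamily`, the registered
binder `stub_carlsonToledoFamily` via `nonempty_carlsonToledoFamily_of_cyclicReflectionSystem`) BUNDLES, for the
CONSTRUCTED universal family `cyclicCoverFamily p : 𝒴 ⟶ S` of smooth `p`-cyclic covers `X_F = V(x₃^p − f) ⊂ ℙ³`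
of `ℙ²`: §2 (identification of the fibre with the model and of the covering automorphism), §3 (the monodromy
group is GENERATED by the meridians' local monodromies; Zariski–van Kampen), §6 Proposition (each local monodromy is
the cyclic reflection on a `(p−1)`-dimensional non-degenerate invariant-free vanishing space), §7 (the vanishing
spaces form ONE orbit and SPAN the anti-invariant part). The §3 generation and the §7 clauses are CONSEQUENCES
of per-meridian data and of tree theorems (Zariski–van Kampen `…meridians_normalClosure_eq_top_holds`,
meridian conjugacy `…meridian_isConj_holds`, the ternary discriminant `exists_irreducible_discriminantForm`,
the linear algebra `nonempty_cyclicReflectionSystem_of_meridians`); this file types the two printed statements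
that remain INPUTS, on the tree's own objects (no existential family, no chosen identification):

* `carlsonToledo1999_meridianMonodromy_isCyclicReflection` — **§1 + §6 Proposition (LOCAL)**: for the
  identification `e : 𝒴_{[F]} ≅ X_F` COMPATIBLE WITH THE EMBEDDINGS INTO `ℙ³` (unique; it exists by the
  argument of `Motives.UniversalHypersurface.exists_fiberIsoM_comp_hypersurfaceι`) and the automorphism `τ` of
  `H²(𝒴_{[F]}; ℚ)` matched by `e` with the deck transformation `σ_F^*`, the rational monodromy along EVERY
  meridian of the discriminant (a leashed transversal disc at a smooth point of `Δ̃ = {f singular}`, the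
  tree's `FundamentalGroup.Meridian`, read in ANY coefficient chart `S(ℂ) ≃ₜ {D ≠ 0}`, `D` an irreducible
  equation of `Δ̃`) is the CYCLIC REFLECTION (`IsCyclicReflection`) along the vanishing space `ℚ[τ]δ` of a
  vector `δ ≠ 0` with `Σ_{i<p} τ^i δ = 0`, `dim ℚ[τ]δ = p − 1`, cup form non-degenerate on `ℚ[τ]δ`.
* `carlsonToledo1999_monodromyInvariants_eq_deckInvariants` — **§3 ¶2 / §7 last ¶ (Deligne's theorem of the
  fixed part on this family)**: every class of `H²(𝒴_{[F]}; ℚ)` fixed by the monodromy group is fixed by `τ`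
  ("`V^⊥` is the space of invariant cycles. The image of `Hⁿ(𝐗̄)` […] also consists of invariant cycles. By
  theorem 4.1.1 […] this inclusion is an equality", applied "by the same argument" to the cyclic family, whose
  total space over `ℂ^{N+1}` is an affine-space bundle over `ℙ³ ∖ pt`, so that the image is `ℚ·h ⊆ H²(Y)^{σ}`).
  This is WEAKER than the printed spanning clause and is what the derivation of spanning consumes; its intended
  discharge is the tree's `deligne_globalInvariantCycles` with the incidence variety of the family.

## Source, verbatim ([CarlsonToledo1999], arXiv text `paper:arxiv-alg-geom_9708002`)

* §1 (p0003): "Consider a smooth point `c` of the discriminant locus. For these `X_c` has exactly one node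
  […] Consider also a loop `γ = γ_c` defined by following a path `α` from the base point to the edge of a
  complex disk normal to `Δ` and centered at `c`, traveling once around the circle bounding this disk, and then
  returning to the base point along `α` reversed. […] we call these loops (and also their homotopy classes) the
  meridians of `Δ`."
* §2 (p0004–p0005): "The resulting universal family of cyclic covers `𝐘` is defined on `ℂ^{N+1} − {0}` and has
  smooth fibers over `Ũ = ℂ^{N+1} − Δ̃`, where `Δ̃` is the pre-image of `Δ`"; the monodromy lies in the "group
  `G̃` of automorphisms of `H^{n+1}(Y_õ, ℂ)` which commute with the cyclic group of covering transformations
  (and which preserve the hyperplane class and the cup product)"; "`H^{n+1}(Y,ℂ)_0 = ⊕_{μ ≠ 1} H(μ)`".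
* §3 (p0006): "A cycle orthogonal to `V = V^n(X_o)` is invariant under all Picard-Lefschetz transformations,
  hence is invariant under the action of monodromy. Consequently its orthogonal complement `V^⊥` is the space
  of invariant cycles. The image of `H^n(𝐗̄)` in `H^n(X_o)` also consists of invariant cycles. By theorem 4.1.1
  (or corollary (4.1.2)) of [DeHodgeTwo], this inclusion is an equality."
* §6 (p0013–p0014): "the space of vanishing cycles `V` for the singularity (kdoublept) is `(k−1)`-dimensional
  and […] the local monodromy transformation is `T = σ_0⊗(−1)⊗⋯⊗(−1)`"; "suppose that `k` is odd. Then the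
  intersection form on the space `V` of local vanishing cycles […] is nondegenerate. Consequently
  `H^{n+1}(Y_õ)` splits orthogonally as `V ⊕ V^⊥`. The action on `H^{n+1}(Y_õ)` of the monodromy transformation
  `T` for the meridian corresponding to the degeneration (kdoublept) is given by (TVcxreflectionformula) on `V`
  and by the identity on `V^⊥`." **Proposition.** "Let `T` be the monodromy corresponding to a generic
  degeneration of the branch locus, as in (kdoublept). Then `T` acts on the `i`-th eigenspace of the cyclic
  automorphism `σ` […] by a complex reflection with eigenvalue `λ_i = (−1)^{n+1} ζ^i`."
* §7 (p0016): "By the same argument as used in §3, one sees that the complex vanishing cycles span `H(i)`."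

## Rendering (case `n = 1`, `k = d = p` odd, `3 ≤ p`, as the bundled fact)

Base `S = cyclicCoverBase p` (ternary `p`-forms `f_t = Σ_e t(b_e) x^e`, `branchForm p t`, with `x₃^p − f_t`
nonsingular), family `u = cyclicCoverFamily p`, classifying point `cyclicCoverPoint p f`, local system
`cyclicCoverFamily_locallyTrivial p`, rational transports `IsRatTransport` and monodromy group
`ratMonodromyGroup u 2 _ ⟨[F], _⟩` (`AlgebraicMonodromyMumfordTate`). The discriminant `Δ̃ ⊂ ℂ^{TernaryIndex p}`
is `{b | x₃^p − f_b singular}` (`= {b | V(f_b) singular}`); an equation `D` of it is any irreducible polynomial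
with this zero set (exists: `UniversalHypersurfaceDiscriminantExists`, `n = 1`); a coefficient chart is any
homeomorphism `χ : S(ℂ) ≃ₜ {D ≠ 0} = affineHypersurfaceComplement ![D]` reading the coefficients of `f_t`
(exists; the consumer constructs it); a meridian is the tree's `Meridian ![D] (χ [F]) 0` and its loop is read
back in `S(ℂ)` as any `γ : Path [F] [F]` with `χ ∘ γ = μ.loop`. For surfaces (`n + 1 = 2` even) the Proposition's
`λ_i = ζ^i`: on the vanishing space the local monodromy IS the covering automorphism, whence
`IsCyclicReflection B τ δ T` (`T = τ` on `ℚ[τ]δ`, `T = id` on the `B`-orthogonal); which of `σ^*`, `(σ⁻¹)^*` and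
which orientation of the meridian only exchange `T` and `T⁻¹`, both cyclic reflections along the same space
for `τ` resp. `τ⁻¹` — the statement is made for the `τ` matched with `diagonalAut (cyclicCoverForm p f) _`
(`x₃ ↦ ζ_p x₃`) exactly as in the bundled fact, of which it is a clause-by-clause weakening.

## What is NOT here

The local analytic theory (Milnor fibre of `y^p = uv`, Sebastiani–Thom, Pham) behind §6 and the classical
fact that smooth points of the discriminant are one-nodal curves (§1) — the content of the first fact; Deligne's
theorem of the fixed part for this family — the content of the second; the DERIVATION of the bundled package
from these two facts (Summits side, seat `hodge-nonav-prover-Bx`).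

## References

* [CarlsonToledo1999] J. A. Carlson, D. Toledo, Discriminant complements and kernels of monodromy
  representations, Duke Math. J. 97 (1999) 621–648; arXiv alg-geom/9708002, §1 (p0003), §2 (p0004–p0005),
  §3 (p0006–p0007), §6 Proposition (p0013–p0014), §7 last paragraph (p0016).
* [DeligneHodgeII1971] P. Deligne, Théorie de Hodge II, Publ. Math. IHÉS 40 (1971), Thm. 4.1.1, Cor. 4.1.2.
* [Shimada2010ZvK] I. Shimada, Lectures on Zariski–van Kampen theorem, arXiv:0906.1074, §3 (leashed discs).
-/

noncomputable section

namespace Literature.AlgebraicGeometry.HodgeTheory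

open CategoryTheory
open Literature.AlgebraicTopology.SingularHomology
open Literature.AlgebraicGeometry.Motives Literature.AlgebraicGeometry.Motives.UniversalHypersurface
open Literature.AlgebraicGeometry.HodgeTheory.UniversalHypersurface
open Literature.AlgebraicGeometry.FundamentalGroup

section MeridianMonodromy

variable (p : ℕ)

/-- The loop `γ` at `s ∈ S(ℂ)` as a homotopy class of loops in the subspace `Set.univ ⊆ S(ℂ)`, on which the
transports `transportFun` / `IsRatTransport` of `cyclicCoverFamily p` are indexed (the cohomological local
trivialisation `cyclicCoverFamily_locallyTrivial p` lives on `Set.univ`). [folklore] -/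
def cyclicCoverLoopClass {s : ComplexPoints (cyclicCoverBase p)} (γ : Path s s) :
    Path.Homotopic.Quotient (⟨s, Set.mem_univ s⟩ : (Set.univ : Set (ComplexPoints (cyclicCoverBase p))))
      ⟨s, Set.mem_univ s⟩ :=
  ⟦γ.map (continuous_id.subtype_mk fun x : ComplexPoints (cyclicCoverBase p) => Set.mem_univ x)⟧

/-- **`e : 𝒴_{s} ≅ X_F` is compatible with the embeddings into `ℙ³`**: `e` followed by `X_F ↪ ℙ³` is the
projection `𝒴_s → 𝒴 → 𝒴_U → ℙ³` of the fibre of the Carlson–Toledo family (the fibre of (universalcyclic)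
over `a` IS `{y^p + f_a = 0} ⊂ ℙ³`). Such an `e` is unique (the embedding is a monomorphism); it exists by the
argument of `Motives.UniversalHypersurface.exists_fiberIsoM_comp_hypersurfaceι`.
[cite: CarlsonToledo1999, §2 (universalcyclic) (held text p0004–p0005)] -/
def IsCompatibleFibreIso {f : MvPolynomial (Fin 3) ℂ} {s : ComplexPoints (cyclicCoverBase p)}
    (e : fiberOver (cyclicCoverFamily p) s ≅ SmoothHypersurface.hypersurface (cyclicCoverForm p f)) : Prop :=
  e.hom ≫ SmoothHypersurface.hypersurfaceι (cyclicCoverForm p f) =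
    fiberι (cyclicCoverFamily p) s ≫ totalSpzToTotal ℂ 2 p (cyclicCoverSpz p) ≫
      Literature.AlgebraicGeometry.HodgeTheory.UniversalHypersurface.toProjectiveSpace ℂ 2 p

/-- Unfolding of `IsCompatibleFibreIso`. [cite: CarlsonToledo1999, §2 (universalcyclic) (held text p0004–p0005)] -/
theorem isCompatibleFibreIso_iff {f : MvPolynomial (Fin 3) ℂ} {s : ComplexPoints (cyclicCoverBase p)}
    (e : fiberOver (cyclicCoverFamily p) s ≅ SmoothHypersurface.hypersurface (cyclicCoverForm p f)) :
    IsCompatibleFibreIso p e ↔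
      e.hom ≫ SmoothHypersurface.hypersurfaceι (cyclicCoverForm p f) =
        fiberι (cyclicCoverFamily p) s ≫ totalSpzToTotal ℂ 2 p (cyclicCoverSpz p) ≫
          Literature.AlgebraicGeometry.HodgeTheory.UniversalHypersurface.toProjectiveSpace ℂ 2 p :=
  Iff.rfl

/-- **`D` is an equation of the discriminant `Δ̃` of the cyclic family**: a polynomial in the coefficients
`b_e` of ternary `p`-forms vanishing exactly at the `b` whose cyclic cover form `x₃^p − Σ_e b_e x^e` is
singular ("`Δ̃` is the pre-image of `Δ`": `x₃^p − f` is singular iff `V(f)` is). For `p ≥ 2` an IRREDUCIBLE such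
`D` exists (the ternary discriminant, `exists_irreducible_discriminantForm`).
[cite: CarlsonToledo1999, §2 (held text p0004)] -/
def IsDiscriminantEquation (D : MvPolynomial (TernaryIndex p) ℂ) : Prop :=
  ∀ b : TernaryIndex p → ℂ, MvPolynomial.eval b D = 0 ↔
    ¬ SmoothHypersurface.IsNonsingularForm ℂ
      (cyclicCoverForm p (∑ e : TernaryIndex p, MvPolynomial.monomial e.1 (b e)))

/-- Unfolding of `IsDiscriminantEquation`. [cite: CarlsonToledo1999, §2 (held text p0004)] -/
theorem isDiscriminantEquation_iff (D : MvPolynomial (TernaryIndex p) ℂ) :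
    IsDiscriminantEquation p D ↔ ∀ b : TernaryIndex p → ℂ, MvPolynomial.eval b D = 0 ↔
      ¬ SmoothHypersurface.IsNonsingularForm ℂ
        (cyclicCoverForm p (∑ e : TernaryIndex p, MvPolynomial.monomial e.1 (b e))) :=
  Iff.rfl

/-- **`χ` is a coefficient chart of the base**: a homeomorphism of `S(ℂ)` onto the complement `{D ≠ 0} ⊂
ℂ^{TernaryIndex p}` which reads the coefficients `b_e = coeff_e f_t` of the branch form of each point (the
presentation "`Ũ = ℂ^{N+1} − Δ̃`"; it exists and is unique, the consumer constructs it).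
[cite: CarlsonToledo1999, §2 (held text p0004)] -/
def IsCoefficientChart (D : MvPolynomial (TernaryIndex p) ℂ)
    (χ : ComplexPoints (cyclicCoverBase p) ≃ₜ affineHypersurfaceComplement ![D]) : Prop :=
  ∀ (t : ComplexPoints (cyclicCoverBase p)) (e : TernaryIndex p),
    (χ t : TernaryIndex p → ℂ) e = (branchForm p t).coeff e.1

/-- Unfolding of `IsCoefficientChart`. [cite: CarlsonToledo1999, §2 (held text p0004)] -/
theorem isCoefficientChart_iff (D : MvPolynomial (TernaryIndex p) ℂ)
    (χ : ComplexPoints (cyclicCoverBase p) ≃ₜ affineHypersurfaceComplement ![D]) :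
    IsCoefficientChart p D χ ↔ ∀ (t : ComplexPoints (cyclicCoverBase p)) (e : TernaryIndex p),
      (χ t : TernaryIndex p → ℂ) e = (branchForm p t).coeff e.1 :=
  Iff.rfl

end MeridianMonodromy

/-! ### The two named facts -/

/-- **Named fact (Carlson–Toledo 1999, §1 + §2 + §6 Proposition; case `n = 1`, `k = d = p` odd, `p ≥ 3`):
the monodromy of EVERY MERIDIAN of the discriminant of the universal family of `p`-cyclic covers of the plane
is the CYCLIC REFLECTION.** For a non-zero ternary `p`-form `f` with smooth cover `X_F = V(x₃^p − f)`, the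
identification `e : 𝒴_{[F]} ≅ X_F` compatible with the embeddings into `ℙ³` and the automorphism `τ` of
`H²(𝒴_{[F]}(ℂ); ℚ)` matched by `e` with the deck transformation `σ_F^*` (`σ_F : x₃ ↦ ζ_p x₃`,
`diagonalAut (cyclicCoverForm p f) _`); an irreducible equation `D` of the discriminant
`Δ̃ = {b | x₃^p − f_b singular}`, a coefficient chart `χ : S(ℂ) ≃ₜ {D ≠ 0}`, a meridian `μ` of `V(D)` based at
`χ [F]` (leash to a transversal straight disc centred at a point of `V(D)`, §1: "a smooth point `c` of the
discriminant locus. For these `X_c` has exactly one node"), and its loop `γ` read in `S(ℂ)`: the rational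
transport `T` of `R² u_* ℚ` along `γ` exists and is the cyclic reflection (`τ` on `ℚ[τ]δ`, identity on the
orthogonal for the cup form `B = transportedTraceForm hX e 2`) along the vanishing space `ℚ[τ]δ` of a vector
`δ ≠ 0` with `Σ_{i<p} τ^i δ = 0` ("eigenvalues `μ ≠ 1`"), `dim ℚ[τ]δ = p − 1` ("`(k−1)`-dimensional") and `B`
non-degenerate on `ℚ[τ]δ` ("`k` odd […] nondegenerate") — UP TO ORIENTATION: `T` or `T⁻¹` is that cyclic
reflection (which one depends only on the conventions for `σ` versus `σ⁻¹` and for the sense of the meridian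
circle; both are cyclic reflections along the same space, for `τ` resp. `τ⁻¹`). The LOCAL clause of the
bundled `carlsonToledo1999_cyclicReflectionSystem`, for every meridian rather than an unspecified set `R`.
`-- TODO(general form): k ∣ d, k and d odd, any n: T = (−1)^{n+1}σ on the vanishing space (CT99 §6).`
[cite: CarlsonToledo1999, §1 (held text p0003), §2 (universalcyclic) (p0004–p0005), §6 Proposition (p0013–p0014)] -/
def carlsonToledo1999_meridianMonodromy_isCyclicReflection : Prop :=
  ∀ ⦃p : ℕ⦄ [NeZero p], Odd p → 3 ≤ p →
    ∀ (f : MvPolynomial (Fin 3) ℂ), f.IsHomogeneous p → f ≠ 0 →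
    ∀ (hX : IsSmoothProjective 2 (SmoothHypersurface.hypersurface (cyclicCoverForm p f)))
      (e : fiberOver (cyclicCoverFamily p) (cyclicCoverPoint p f) ≅
        SmoothHypersurface.hypersurface (cyclicCoverForm p f)), IsCompatibleFibreIso p e →
    ∀ (τ : bettiCohomology (fiberOver (cyclicCoverFamily p) (cyclicCoverPoint p f)) 2 ≃ₗ[ℚ]
        bettiCohomology (fiberOver (cyclicCoverFamily p) (cyclicCoverPoint p f)) 2),
      (∀ (ha : deckUnit p ∈ diagonalStabilizer (cyclicCoverForm p f))
          (x : bettiCohomology (fiberOver (cyclicCoverFamily p) (cyclicCoverPoint p f)) 2),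
          BettiUniverse.pullEquiv e 2 (τ x) =
            BettiUniverse.pull (diagonalAut (cyclicCoverForm p f) ha) 2 (BettiUniverse.pullEquiv e 2 x)) →
    ∀ (D : MvPolynomial (TernaryIndex p) ℂ), Irreducible D → IsDiscriminantEquation p D →
    ∀ (χ : ComplexPoints (cyclicCoverBase p) ≃ₜ affineHypersurfaceComplement ![D]), IsCoefficientChart p D χ →
    ∀ (μ : Meridian ![D] (χ (cyclicCoverPoint p f)) 0)
      (γ : Path (cyclicCoverPoint p f) (cyclicCoverPoint p f)), (∀ θ, χ (γ θ) = μ.loop θ) →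
    ∃ (T : bettiCohomology (fiberOver (cyclicCoverFamily p) (cyclicCoverPoint p f)) 2 ≃ₗ[ℚ]
          bettiCohomology (fiberOver (cyclicCoverFamily p) (cyclicCoverPoint p f)) 2)
      (δ : bettiCohomology (fiberOver (cyclicCoverFamily p) (cyclicCoverPoint p f)) 2),
      IsRatTransport (cyclicCoverFamily p) 2 (cyclicCoverFamily_locallyTrivial p) (cyclicCoverLoopClass p γ) T ∧
      δ ≠ 0 ∧ (∑ i ∈ Finset.range p, (τ ^ i) δ) = 0 ∧
      Module.finrank ℚ (cyclicSpan τ δ) = p - 1 ∧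
      (∀ x ∈ cyclicSpan τ δ, (∀ y ∈ cyclicSpan τ δ, transportedTraceForm hX e 2 x y = 0) → x = 0) ∧
      (IsCyclicReflection (transportedTraceForm hX e 2) τ δ T ∨
        IsCyclicReflection (transportedTraceForm hX e 2) τ δ T⁻¹)

/-- **Named fact (Carlson–Toledo 1999, §3 second paragraph with Deligne, Hodge II Thm. 4.1.1, read on the
universal family of cyclic covers as in §7, last paragraph; case `n = 1`, `k = d = p` odd, `p ≥ 3`): the
monodromy invariants of `H²(𝒴_{[F]}; ℚ)` are invariant under the covering transformation.** With `e`, `τ` as in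
`carlsonToledo1999_meridianMonodromy_isCyclicReflection`: every `x ∈ H²(𝒴_{[F]}(ℂ); ℚ)` fixed by the whole
monodromy group `ratMonodromyGroup u 2 _ [F]` satisfies `τ x = x`. Printed route: invariant cycles are the image of
`H²` of the total space over `ℂ^{N+1}` (Deligne 4.1.1), an affine-space bundle over `ℙ³` minus a point, so they
are multiples of the hyperplane class, which the covering group fixes (§2: the monodromy preserves the hyperplane
class; "`H^{n+1}(Y,ℂ)_0 = ⊕_{μ≠1} H(μ)`"). WEAKER than the printed spanning clause "the complex vanishing cycles
span `H(i)`" (§7), to which it is equivalent granted the local fact (`nonempty_cyclicReflectionSystem_of_meridians`).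
Intended discharge: the tree's `deligne_globalInvariantCycles` with the incidence variety of the family.
[cite: CarlsonToledo1999, §3 (held text p0006), §2 (p0005) and §7 last paragraph (p0016)]
[cite: DeligneHodgeII1971, Thm. 4.1.1 and Cor. 4.1.2] -/
def carlsonToledo1999_monodromyInvariants_eq_deckInvariants : Prop :=
  ∀ ⦃p : ℕ⦄ [NeZero p], Odd p → 3 ≤ p →
    ∀ (f : MvPolynomial (Fin 3) ℂ), f.IsHomogeneous p → f ≠ 0 →
    ∀ (hX : IsSmoothProjective 2 (SmoothHypersurface.hypersurface (cyclicCoverForm p f)))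
      (e : fiberOver (cyclicCoverFamily p) (cyclicCoverPoint p f) ≅
        SmoothHypersurface.hypersurface (cyclicCoverForm p f)), IsCompatibleFibreIso p e →
    ∀ (τ : bettiCohomology (fiberOver (cyclicCoverFamily p) (cyclicCoverPoint p f)) 2 ≃ₗ[ℚ]
        bettiCohomology (fiberOver (cyclicCoverFamily p) (cyclicCoverPoint p f)) 2),
      (∀ (ha : deckUnit p ∈ diagonalStabilizer (cyclicCoverForm p f))
          (x : bettiCohomology (fiberOver (cyclicCoverFamily p) (cyclicCoverPoint p f)) 2),
          BettiUniverse.pullEquiv e 2 (τ x) =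
            BettiUniverse.pull (diagonalAut (cyclicCoverForm p f) ha) 2 (BettiUniverse.pullEquiv e 2 x)) →
    ∀ x : bettiCohomology (fiberOver (cyclicCoverFamily p) (cyclicCoverPoint p f)) 2,
      (∀ g ∈ ratMonodromyGroup (cyclicCoverFamily p) 2 (cyclicCoverFamily_locallyTrivial p)
          ⟨cyclicCoverPoint p f, Set.mem_univ _⟩, g x = x) → τ x = x

/-! ### Proved consumer shapes -/

section Consumer

variable {p : ℕ} [NeZero p]

/-- The meridian monodromy supplied by the local fact is an element of the monodromy group
`ratMonodromyGroup u 2 _ [F]` (it is the rational transport of a loop).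
[cite: CarlsonToledo1999, §6 Proposition (held text p0014)] -/
theorem carlsonToledo1999_meridianMonodromy_isCyclicReflection.exists_mem_ratMonodromyGroup
    (H : carlsonToledo1999_meridianMonodromy_isCyclicReflection) (hodd : Odd p) (h3 : 3 ≤ p)
    {f : MvPolynomial (Fin 3) ℂ} (hf : f.IsHomogeneous p) (hf0 : f ≠ 0)
    (hX : IsSmoothProjective 2 (SmoothHypersurface.hypersurface (cyclicCoverForm p f)))
    {e : fiberOver (cyclicCoverFamily p) (cyclicCoverPoint p f) ≅
      SmoothHypersurface.hypersurface (cyclicCoverForm p f)} (he : IsCompatibleFibreIso p e)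
    {τ : bettiCohomology (fiberOver (cyclicCoverFamily p) (cyclicCoverPoint p f)) 2 ≃ₗ[ℚ]
      bettiCohomology (fiberOver (cyclicCoverFamily p) (cyclicCoverPoint p f)) 2}
    (hτ : ∀ (ha : deckUnit p ∈ diagonalStabilizer (cyclicCoverForm p f))
      (x : bettiCohomology (fiberOver (cyclicCoverFamily p) (cyclicCoverPoint p f)) 2),
      BettiUniverse.pullEquiv e 2 (τ x) =
        BettiUniverse.pull (diagonalAut (cyclicCoverForm p f) ha) 2 (BettiUniverse.pullEquiv e 2 x))
    {D : MvPolynomial (TernaryIndex p) ℂ} (hD : Irreducible D) (hDeq : IsDiscriminantEquation p D)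
    {χ : ComplexPoints (cyclicCoverBase p) ≃ₜ affineHypersurfaceComplement ![D]} (hχ : IsCoefficientChart p D χ)
    (μ : Meridian ![D] (χ (cyclicCoverPoint p f)) 0)
    (γ : Path (cyclicCoverPoint p f) (cyclicCoverPoint p f)) (hγ : ∀ θ, χ (γ θ) = μ.loop θ) :
    ∃ T ∈ ratMonodromyGroup (cyclicCoverFamily p) 2 (cyclicCoverFamily_locallyTrivial p)
        ⟨cyclicCoverPoint p f, Set.mem_univ _⟩,
      ∃ δ : bettiCohomology (fiberOver (cyclicCoverFamily p) (cyclicCoverPoint p f)) 2,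
        IsRatTransport (cyclicCoverFamily p) 2 (cyclicCoverFamily_locallyTrivial p)
          (cyclicCoverLoopClass p γ) T ∧
        δ ≠ 0 ∧ (∑ i ∈ Finset.range p, (τ ^ i) δ) = 0 ∧
        Module.finrank ℚ (cyclicSpan τ δ) = p - 1 ∧
        (∀ x ∈ cyclicSpan τ δ, (∀ y ∈ cyclicSpan τ δ, transportedTraceForm hX e 2 x y = 0) → x = 0) ∧
        (IsCyclicReflection (transportedTraceForm hX e 2) τ δ T ∨
          IsCyclicReflection (transportedTraceForm hX e 2) τ δ T⁻¹) := by
  obtain ⟨T, δ, hT, hrest⟩ := H hodd h3 f hf hf0 hX e he τ hτ D hD hDeq χ hχ μ γ hγ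
  exact ⟨T, mem_ratMonodromyGroup_of_isRatTransport _ _ _ hT, δ, hT, hrest⟩

/-- **The cyclic reflection of a meridian lies in the monodromy group** (convention-free form, the clause
`exists_mem_isCyclicReflection` of the bundled package): with the data of the local fact, some element of
`ratMonodromyGroup u 2 _ [F]` — the meridian's transport or its inverse — is the cyclic reflection along the
vanishing space `ℚ[τ]δ`. [cite: CarlsonToledo1999, §6 Proposition (held text p0014)] -/
theorem carlsonToledo1999_meridianMonodromy_isCyclicReflection.exists_reflection_mem_ratMonodromyGroup
    (H : carlsonToledo1999_meridianMonodromy_isCyclicReflection) (hodd : Odd p) (h3 : 3 ≤ p)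
    {f : MvPolynomial (Fin 3) ℂ} (hf : f.IsHomogeneous p) (hf0 : f ≠ 0)
    (hX : IsSmoothProjective 2 (SmoothHypersurface.hypersurface (cyclicCoverForm p f)))
    {e : fiberOver (cyclicCoverFamily p) (cyclicCoverPoint p f) ≅
      SmoothHypersurface.hypersurface (cyclicCoverForm p f)} (he : IsCompatibleFibreIso p e)
    {τ : bettiCohomology (fiberOver (cyclicCoverFamily p) (cyclicCoverPoint p f)) 2 ≃ₗ[ℚ]
      bettiCohomology (fiberOver (cyclicCoverFamily p) (cyclicCoverPoint p f)) 2}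
    (hτ : ∀ (ha : deckUnit p ∈ diagonalStabilizer (cyclicCoverForm p f))
      (x : bettiCohomology (fiberOver (cyclicCoverFamily p) (cyclicCoverPoint p f)) 2),
      BettiUniverse.pullEquiv e 2 (τ x) =
        BettiUniverse.pull (diagonalAut (cyclicCoverForm p f) ha) 2 (BettiUniverse.pullEquiv e 2 x))
    {D : MvPolynomial (TernaryIndex p) ℂ} (hD : Irreducible D) (hDeq : IsDiscriminantEquation p D)
    {χ : ComplexPoints (cyclicCoverBase p) ≃ₜ affineHypersurfaceComplement ![D]} (hχ : IsCoefficientChart p D χ)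
    (μ : Meridian ![D] (χ (cyclicCoverPoint p f)) 0)
    (γ : Path (cyclicCoverPoint p f) (cyclicCoverPoint p f)) (hγ : ∀ θ, χ (γ θ) = μ.loop θ) :
    ∃ (T r : bettiCohomology (fiberOver (cyclicCoverFamily p) (cyclicCoverPoint p f)) 2 ≃ₗ[ℚ]
        bettiCohomology (fiberOver (cyclicCoverFamily p) (cyclicCoverPoint p f)) 2)
      (δ : bettiCohomology (fiberOver (cyclicCoverFamily p) (cyclicCoverPoint p f)) 2),
      IsRatTransport (cyclicCoverFamily p) 2 (cyclicCoverFamily_locallyTrivial p) (cyclicCoverLoopClass p γ) T ∧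
      (r = T ∨ r = T⁻¹) ∧
      r ∈ ratMonodromyGroup (cyclicCoverFamily p) 2 (cyclicCoverFamily_locallyTrivial p)
        ⟨cyclicCoverPoint p f, Set.mem_univ _⟩ ∧
      δ ≠ 0 ∧ (∑ i ∈ Finset.range p, (τ ^ i) δ) = 0 ∧
      Module.finrank ℚ (cyclicSpan τ δ) = p - 1 ∧
      (∀ x ∈ cyclicSpan τ δ, (∀ y ∈ cyclicSpan τ δ, transportedTraceForm hX e 2 x y = 0) → x = 0) ∧
      IsCyclicReflection (transportedTraceForm hX e 2) τ δ r := by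
  obtain ⟨T, δ, hT, h0, hΦ, hdim, hnd, hrefl⟩ := H hodd h3 f hf hf0 hX e he τ hτ D hD hDeq χ hχ μ γ hγ
  have hTΓ : T ∈ ratMonodromyGroup (cyclicCoverFamily p) 2 (cyclicCoverFamily_locallyTrivial p)
      ⟨cyclicCoverPoint p f, Set.mem_univ _⟩ := mem_ratMonodromyGroup_of_isRatTransport _ _ _ hT
  rcases hrefl with hrefl | hrefl
  · exact ⟨T, T, δ, hT, Or.inl rfl, hTΓ, h0, hΦ, hdim, hnd, hrefl⟩
  · exact ⟨T, T⁻¹, δ, hT, Or.inr rfl, Subgroup.inv_mem _ hTΓ, h0, hΦ, hdim, hnd, hrefl⟩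

end Consumer

end Literature.AlgebraicGeometry.HodgeTheory

end
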